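import Literature.NumberTheory.Sieve.RoughOmegaCells
import Literature.NumberTheory.Sieve.LinearEquationsInPrimesDimOne
import Mathlib.RingTheory.Coprime.Lemmas
import HarnessLib

/-!
# Ω-cells of the rough integers along a progression segment

Topic `Literature/NumberTheory/Sieve`. Everything here is PROVED. Fix a scale `N`, `u ≥ 1`,
`z = N^{1/u}`, `T = ⌊z⌋ + 1` and a cell index `j = i + 1`. For a progression `v = a m + b` (`a > 0`)
over an integer interval `m ∈ [m₁, m₂]` we count the `m` whose value is `z`-rough with `Ω = j`,
`#{m ∈ [m₁, m₂] : P⁻(a m + b) > z, Ω(a m + b) = j}`, and compare it with `(a (m₂ − m₁ + 1)/φ(a)) · A_j(N)/N`,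
`A_j(N) = #{v ∈ roughIcc T N : Ω v = j}` (sub-namespace `RoughCellsSegment`):

* `filter_Icc_rough_cell_eq` — `{1 ≤ v ≤ V : v ≡ r, P⁻(v) > z, Ω v = j} = {v ∈ roughIcc T V : Ω v = j, v ≡ r}`
  (`j ≥ 1`);
* `card_filter_Ioc_eq_sub` — counts over `(V₁, V₂]` are differences of counts over `[1, V]`;
* `card_filter_Icc_eq_zero_of_dvd` — if `g ≥ 2` divides `a` and `b` and `g < z`, no value `a m + b`
  is `z`-rough: the count vanishes (the local obstruction `gcd(a, b) > 1`);
* `abs_card_segment_sub_le` — **the segment law from the local law**: if the class counts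
  `Φ_j(V; q, r) = #{v ∈ roughIcc T V : Ω v = j, v ≡ r (q)}` obey
  `|Φ_j(V₂; q, r) − Φ_j(V₁; q, r) − ((V₂ − V₁)/φ(q)) A_j(N)/N| ≤ E` for `q ≤ L`, `(r, q) = 1`,
  `V₁ ≤ V₂ ≤ L N` (the conclusion of `RoughCellsLocal.exists_forall_abs_cellClass_segment_sub_le`,
  taken as a hypothesis), then for `gcd(a, b) = 1`, `a ≤ L`, `a m₁ + b > 0`, `a m₂ + b ≤ L N`:
  `|#{m ∈ [m₁, m₂] : P⁻(a m + b) > z, Ω = j} − (a (m₂ − m₁ + 1)/φ(a)) A_j(N)/N| ≤ E + a`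
  (the values form the AP segment `(a(m₁−1)+b, a m₂ + b] ∩ (b mod a)`, `DimOne.card_filter_Icc_eq_card_filter_Ioc`;
  the possible truncation of the lower end at `0` costs at most `a` values).

## References

* K. Alladi, *The distribution of ν(n) in the sieve of Eratosthenes*, Quart. J. Math. Oxford (2) 33
  (1982), 129–148. [Alladi1982]
-/

open Finset
open scoped ArithmeticFunction.Omega

noncomputable section

namespace Literature.NumberTheory.Sieve

namespace RoughCellsSegment

/-! ### Bookkeeping of the counts -/

/-- For `j ≥ 1`: `{1 ≤ v ≤ V : v ≡ r (q), z < P⁻(v), Ω v = j} = {v ∈ roughIcc (⌊z⌋ + 1) V : Ω v = j, v ≡ r (q)}`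
(`v ≠ 1` as `Ω v ≥ 1`, and `z < P⁻(v)` iff every prime factor is `≥ ⌊z⌋ + 1`). [folklore] -/
theorem filter_Icc_rough_cell_eq {z : ℝ} (hz : 0 ≤ z) (V q r : ℕ) {j : ℕ} (hj : 1 ≤ j) :
    (Finset.Icc 1 V).filter (fun v => v ≡ r [MOD q] ∧ (z < (Nat.minFac v : ℝ) ∧ Ω v = j)) =
      (roughIcc (⌊z⌋₊ + 1) V).filter (fun v => Ω v = j ∧ v ≡ r [MOD q]) := by
  ext v
  simp only [Finset.mem_filter, Finset.mem_Icc, mem_roughIcc]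
  constructor
  · rintro ⟨hv, hr, hlt, hΩ⟩
    refine ⟨⟨hv, fun p hp hpv => Nat.succ_le_of_lt ((Nat.floor_lt hz).2 ?_)⟩, hΩ, hr⟩
    exact hlt.trans_le (by exact_mod_cast Nat.minFac_le_of_dvd hp.two_le hpv)
  · rintro ⟨⟨hv, hall⟩, hΩ, hr⟩
    refine ⟨hv, hr, ?_, hΩ⟩
    have hv1 : v ≠ 1 := by
      rintro rfl
      rw [ArithmeticFunction.cardFactors_one] at hΩ
      omega
    exact Nat.lt_of_floor_lt (hall _ (Nat.minFac_prime hv1) (Nat.minFac_dvd v))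

/-- Counts over `(V₁, V₂]` are differences of counts over `[1, V₂]` and `[1, V₁]` (`V₁ ≤ V₂`).
[folklore] -/
theorem card_filter_Ioc_eq_sub {V₁ V₂ : ℕ} (h : V₁ ≤ V₂) (P : ℕ → Prop) [DecidablePred P] :
    (#((Finset.Ioc V₁ V₂).filter P) : ℝ) =
      #((Finset.Icc 1 V₂).filter P) - #((Finset.Icc 1 V₁).filter P) := by
  have h1 : Finset.Icc 1 V₂ = Finset.Icc 1 V₁ ∪ Finset.Ioc V₁ V₂ := by
    ext v; simp only [Finset.mem_union, Finset.mem_Icc, Finset.mem_Ioc]; omega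
  have h2 : Disjoint ((Finset.Icc 1 V₁).filter P) ((Finset.Ioc V₁ V₂).filter P) := by
    rw [Finset.disjoint_left]
    intro v hv hv'
    rw [Finset.mem_filter, Finset.mem_Icc] at hv
    rw [Finset.mem_filter, Finset.mem_Ioc] at hv'
    omega
  rw [h1, Finset.filter_union, Finset.card_union_of_disjoint h2]
  push_cast
  ring

/-! ### The local obstruction -/

/-- **A common factor kills every rough value.** If `g ≥ 2` divides `a` and `b` and `g < z`
(`z ≥ 2`), then no value `a m + b` has least prime factor `> z`: the values `≤ 0` are sent to `0`
(`P⁻(0) = 2 ≤ z`) and the positive ones are divisible by `g`. [folklore] -/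
theorem card_filter_Icc_eq_zero_of_dvd {a b : ℤ} {g : ℕ} {z : ℝ} (hg : 2 ≤ g) (hga : (g : ℤ) ∣ a)
    (hgb : (g : ℤ) ∣ b) (hgz : (g : ℝ) < z) (hz : 2 ≤ z) (s : Finset ℤ) (P : ℤ → ℕ → Prop)
    [DecidablePred fun m : ℤ => (z < (Nat.minFac (a * m + b).toNat : ℝ)) ∧ P m (a * m + b).toNat] :
    #(s.filter (fun m => z < (Nat.minFac (a * m + b).toNat : ℝ) ∧ P m (a * m + b).toNat)) = 0 := by
  rw [Finset.card_eq_zero, Finset.filter_eq_empty_iff]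
  rintro m - ⟨hlt, -⟩
  have hdvd : (g : ℤ) ∣ a * m + b := (hga.mul_right m).add hgb
  rcases le_or_gt (a * m + b) 0 with hle | hpos
  · rw [Int.toNat_of_nonpos hle, Nat.minFac_zero] at hlt
    norm_num at hlt
    linarith
  · set v : ℕ := (a * m + b).toNat with hv
    have hv' : (v : ℤ) = a * m + b := Int.toNat_of_nonneg hpos.le
    have hgv : g ∣ v := by rw [← Int.natCast_dvd_natCast, hv']; exact hdvd
    have h1 : (Nat.minFac v : ℝ) ≤ g := by exact_mod_cast Nat.minFac_le_of_dvd hg hgv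
    linarith

/-! ### The segment law from the local law -/

/-- `a m + b` is prime to `a` when `gcd(a, b) = 1`: the representative `(a m + b).toNat` of the class is
reduced modulo `a.toNat` (`a > 0`, `a m + b > 0`). [folklore] -/
theorem coprime_toNat_of_gcd_eq_one {a b m : ℤ} (ha : 0 < a) (hv : 0 < a * m + b)
    (hgcd : Int.gcd a b = 1) : (a * m + b).toNat.Coprime a.toNat := by
  have h1 : IsCoprime b a := by
    rw [Int.isCoprime_iff_gcd_eq_one, Int.gcd_comm]; exact hgcd
  have h2 : IsCoprime (a * m + b) a := h1.mul_add_left_left m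
  rw [Int.isCoprime_iff_gcd_eq_one, Int.gcd_eq_natAbs] at h2
  have e1 : (a * m + b).toNat = (a * m + b).natAbs :=
    Int.natCast_inj.mp (by rw [Int.toNat_of_nonneg hv.le, Int.natAbs_of_nonneg hv.le])
  have e2 : a.toNat = a.natAbs :=
    Int.natCast_inj.mp (by rw [Int.toNat_of_nonneg ha.le, Int.natAbs_of_nonneg ha.le])
  rw [e1, e2]
  exact h2

/-- **The segment law from the local law.** Let `a > 0`, `gcd(a, b) = 1`, `a ≤ L`, `m₁ ≤ m₂` with
`a m₁ + b > 0` and `a m₂ + b ≤ L N`, and assume the local law for the class counts of the cell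
`Ω = i + 1` of the `N^{1/u}`-rough numbers (hypothesis `hloc`, the conclusion of
`RoughCellsLocal.exists_forall_abs_cellClass_segment_sub_le` at this `N`, with error `E`). Then
`|#{m ∈ [m₁, m₂] : P⁻(a m + b) > N^{1/u}, Ω(a m + b) = i+1} − (a (m₂ − m₁ + 1)/φ(a)) · A/N| ≤ E + a`,
`A = #{v ∈ roughIcc (⌊N^{1/u}⌋ + 1) N : Ω v = i + 1}`: the values are the AP segment
`(a(m₁−1)+b, a m₂ + b] ∩ (b mod a)`, a difference of two class counts, and the truncation of its lower
end at `0` changes its length by less than `a`. [folklore] -/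
theorem abs_card_segment_sub_le {N u L i : ℕ} {E : ℝ} {a b m₁ m₂ : ℤ} (ha : 0 < a) (hm : m₁ ≤ m₂)
    (hpos : 0 < a * m₁ + b) (hV : a * m₂ + b ≤ L * N) (hgcd : Int.gcd a b = 1) (haL : a.toNat ≤ L)
    (hloc : ∀ q : ℕ, 0 < q → q ≤ L → ∀ r : ℕ, r.Coprime q → ∀ V₁ V₂ : ℕ, V₁ ≤ V₂ → V₂ ≤ L * N →
      |(#((roughIcc (⌊(N : ℝ) ^ ((1 : ℝ) / u)⌋₊ + 1) V₂).filter
            (fun v => Ω v = i + 1 ∧ v ≡ r [MOD q])) : ℝ) -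
          #((roughIcc (⌊(N : ℝ) ^ ((1 : ℝ) / u)⌋₊ + 1) V₁).filter
            (fun v => Ω v = i + 1 ∧ v ≡ r [MOD q])) -
          ((V₂ : ℝ) - V₁) / Nat.totient q *
            ((#((roughIcc (⌊(N : ℝ) ^ ((1 : ℝ) / u)⌋₊ + 1) N).filter (fun v => Ω v = i + 1)) : ℝ) / N)|
        ≤ E) :
    |(#((Finset.Icc m₁ m₂).filter (fun m => (N : ℝ) ^ ((1 : ℝ) / u) < (Nat.minFac (a * m + b).toNat : ℝ) ∧
          Ω (a * m + b).toNat = i + 1)) : ℝ) -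
        (a.toNat : ℝ) * ((m₂ : ℝ) - m₁ + 1) / Nat.totient a.toNat *
          ((#((roughIcc (⌊(N : ℝ) ^ ((1 : ℝ) / u)⌋₊ + 1) N).filter (fun v => Ω v = i + 1)) : ℝ) / N)|
      ≤ E + a.toNat := by
  set z : ℝ := (N : ℝ) ^ ((1 : ℝ) / u) with hz
  set T : ℕ := ⌊z⌋₊ + 1 with hT
  set q : ℕ := a.toNat with hq
  set V₁ : ℕ := (a * (m₁ - 1) + b).toNat with hV₁
  set V₂ : ℕ := (a * m₂ + b).toNat with hV₂
  set A : ℝ := (#((roughIcc T N).filter (fun v => Ω v = i + 1)) : ℝ) with hA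
  have hz0 : 0 ≤ z := by positivity
  have hq0 : 0 < q := by rw [hq]; omega
  have hqa : (q : ℤ) = a := Int.toNat_of_nonneg ha.le
  have hV₂pos : 0 < a * m₂ + b := lt_of_lt_of_le hpos (by nlinarith)
  have hV₂Z : (V₂ : ℤ) = a * m₂ + b := Int.toNat_of_nonneg hV₂pos.le
  have hV₁₂ : V₁ ≤ V₂ := by
    rw [hV₁, hV₂]
    exact Int.toNat_le_toNat (by nlinarith)
  have hV₂L : V₂ ≤ L * N := by
    have : (V₂ : ℤ) ≤ L * N := by rw [hV₂Z]; exact hV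
    exact_mod_cast this
  have hr : V₂.Coprime q := coprime_toNat_of_gcd_eq_one ha hV₂pos hgcd
  -- the values as an AP segment, and the segment as a difference of two class counts
  have hcount := DimOne.card_filter_Icc_eq_card_filter_Ioc (m₂ := m₂) ha hpos
    (fun v => z < (Nat.minFac v : ℝ) ∧ Ω v = i + 1)
  have hbridge : ∀ V : ℕ, (Finset.Icc 1 V).filter
      (fun v => v ≡ V₂ [MOD q] ∧ (z < (Nat.minFac v : ℝ) ∧ Ω v = i + 1)) =
        (roughIcc T V).filter (fun v => Ω v = i + 1 ∧ v ≡ V₂ [MOD q]) := fun V =>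
    filter_Icc_rough_cell_eq hz0 V q V₂ (by omega)
  have hseg : (#((Finset.Icc m₁ m₂).filter (fun m => z < (Nat.minFac (a * m + b).toNat : ℝ) ∧
      Ω (a * m + b).toNat = i + 1)) : ℝ) =
      #((roughIcc T V₂).filter (fun v => Ω v = i + 1 ∧ v ≡ V₂ [MOD q])) -
        #((roughIcc T V₁).filter (fun v => Ω v = i + 1 ∧ v ≡ V₂ [MOD q])) := by
    rw [hcount, card_filter_Ioc_eq_sub hV₁₂, hbridge, hbridge]
  -- the local law for this segment
  have hL := hloc q hq0 haL V₂ hr V₁ V₂ hV₁₂ hV₂L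
  -- the length of the segment against `a · #[m₁, m₂]`
  have hlen : |((V₂ : ℝ) - V₁) - (q : ℝ) * ((m₂ : ℝ) - m₁ + 1)| ≤ q := by
    have hqR : (q : ℝ) = (a : ℝ) := by exact_mod_cast hqa
    have hV₂R : (V₂ : ℝ) = ((a * m₂ + b : ℤ) : ℝ) := by exact_mod_cast hV₂Z
    rcases le_or_gt 0 (a * (m₁ - 1) + b) with h0 | h0
    · have hV₁Z : (V₁ : ℤ) = a * (m₁ - 1) + b := Int.toNat_of_nonneg h0
      have hV₁R : (V₁ : ℝ) = ((a * (m₁ - 1) + b : ℤ) : ℝ) := by exact_mod_cast hV₁Z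
      rw [hV₂R, hV₁R, hqR]
      push_cast
      ring_nf
      rw [abs_zero]
      positivity
    · have hV₁Z : V₁ = 0 := Int.toNat_of_nonpos h0.le
      rw [hV₁Z, hV₂R, hqR, Nat.cast_zero, sub_zero]
      push_cast
      have h1 : ((a * (m₁ - 1) + b : ℤ) : ℝ) < 0 := by exact_mod_cast h0
      have h2 : (0 : ℝ) < ((a * m₁ + b : ℤ) : ℝ) := by exact_mod_cast hpos
      push_cast at h1 h2
      rw [abs_le]
      constructor <;> nlinarith
  -- `0 ≤ A/N ≤ 1` and `φ(q) ≥ 1`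
  have hAN0 : 0 ≤ A / N := by positivity
  have hAN1 : A / N ≤ 1 := by
    rcases Nat.eq_zero_or_pos N with hN | hN
    · rw [hN, Nat.cast_zero, div_zero]; exact zero_le_one
    · rw [div_le_one (by exact_mod_cast hN), hA]
      exact_mod_cast card_roughIcc_filter_cardFactors_le T N (i + 1)
  have hφ : (1 : ℝ) ≤ Nat.totient q := by exact_mod_cast Nat.totient_pos.mpr hq0
  have hφ0 : (0 : ℝ) < Nat.totient q := by linarith
  -- assembly
  rw [hseg]
  have e : (#((roughIcc T V₂).filter (fun v => Ω v = i + 1 ∧ v ≡ V₂ [MOD q])) : ℝ) -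
      #((roughIcc T V₁).filter (fun v => Ω v = i + 1 ∧ v ≡ V₂ [MOD q])) -
      (q : ℝ) * ((m₂ : ℝ) - m₁ + 1) / Nat.totient q * (A / N) =
      ((#((roughIcc T V₂).filter (fun v => Ω v = i + 1 ∧ v ≡ V₂ [MOD q])) : ℝ) -
        #((roughIcc T V₁).filter (fun v => Ω v = i + 1 ∧ v ≡ V₂ [MOD q])) -
        ((V₂ : ℝ) - V₁) / Nat.totient q * (A / N)) +
      (((V₂ : ℝ) - V₁) - (q : ℝ) * ((m₂ : ℝ) - m₁ + 1)) / Nat.totient q * (A / N) := by ring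
  rw [e]
  refine (abs_add_le _ _).trans (add_le_add hL ?_)
  rw [abs_mul, abs_div, abs_of_pos hφ0, abs_of_nonneg hAN0]
  calc |((V₂ : ℝ) - V₁) - (q : ℝ) * ((m₂ : ℝ) - m₁ + 1)| / Nat.totient q * (A / N)
      ≤ (q : ℝ) / 1 * 1 := by
        refine mul_le_mul (div_le_div₀ (Nat.cast_nonneg q) hlen one_pos hφ) hAN1 hAN0 (by positivity)
    _ = q := by ring

end RoughCellsSegment

end Literature.NumberTheory.Sieve
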